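/-
Origin: expansion seat `planner-pub-hodgecm-qw8-g11-0`, handover #22 SPLIT PART 3/4 of tree `HodgeCM/Model/Toy/LefQuartic.lean` 7081025a (1140 l. > 400-line cap) = NEW module `HodgeCM.Model.Toy.LefQuarticInner` md5 413b7df96ec9d8298de1e62e2817fb75 (348 l.): verbatim section-boundary slice + docstrings; imports: `import Qw8g11.LefQuarticTwist` -> `import HodgeCM.Model.Toy.LefQuarticTwist` (row #21); check-wip LANDABLE rc 0 / 0 warnings / 0 proof-hole; lean -DautoImpl (`HOME/pub-hodgecm-qw8-g11/lean/Qw8g11/LefQuarticInner.lean`, md5 413b7df9, 348 lines);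
landed by the packager successor (mc-unitary-1-g3, gen-8 kit) in gate run 32 as `HodgeCM/Model/Toy/LefQuarticInner.lean` (import ^import Qw8g11\.LefQuarticTwist[ \t]*$→import HodgeCM.Model.Toy.LefQuarticTwist ×1).
-/
-- HANDOVER (planner-pub-hodgecm-qw8-g11-0, unit pub-hodgecm-qw8-g11): SPLIT PART 3/4 of the installed
-- `HodgeCM.Model.Toy.LefQuartic` (md5 7081025a, 1140 l.) = its §§7b–8 (ll. 644–949: `section Inner` in degree 4, `section CntBal`)
-- verbatim; WIP module `Qw8g11.LefQuarticInner`, intended final module `HodgeCM.Model.Toy.LefQuarticInner` (NEW file); at landing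
-- rewrite `import Qw8g11.LefQuarticTwist` ↦ `import HodgeCM.Model.Toy.LefQuarticTwist`.
/-
Copyright: pub-hodgecm cell (HodgeCMPerL). Separating-model layer (gen 8 of the [QW8] §2.5 lineage). New file.
-/
import Summits.HodgeConjecture.HodgeCM.Model.Toy.LefQuarticTwist

/-!
# The Lefschetz model in CM degree at most four, III: inner products in degree four, and balance

Split part 3/4 of `HodgeCM.Model.Toy.LefQuartic` (its §§7b–8, unchanged).

* §7b (`[K:ℚ] = 4`) `triInner_of_finrank_eq_four`: the embeddings are `x, x̄, z, z̄`, the pair orbit of two embeddings over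
  different places has `4` or `8` elements (`tri_inner`), and every inner product `⟨ψ_j, ψ_l⟩` of slot sign vectors over `Ω_K` is
  `0` or `±#Ω_K`, with `+#Ω_K` iff the Galois types agree and `-#Ω_K` iff they are complementary.
* §8 `Obj.Presented K X` (every atom of `X` is `(K, Ψ_i)` read through a ring map `K → F_i`) and
  `Obj.cntBal_of_presented` / `Obj.cntBal_of_presented_of_finrank_le_four`: constant holomorphy count under Galois forces
  balance on objects presented over ONE CM field of degree `≤ 4` (`Obj.cntBal_of_triInner`: `Σ_j ψ_j` constant on `Ω_K`, each
  `ψ_l` of mean zero, so `Σ_j ⟨ψ_j, ψ_l⟩ = 0`, and the trichotomy turns this into `#{j : T_j = T} = #{j : T_j = Tᶜ}`).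

The headlines, the converse and induced types are in `HodgeCM.Model.Toy.LefQuartic`. Nothing here is cited.
-/

noncomputable section

set_option backward.isDefEq.respectTransparency false

namespace HodgeCM.Toy

open scoped TensorProduct
open exteriorPower Module CMPresentation CMTypeOps
open NumberField.ComplexEmbedding (conjugate)
open Literature.AlgebraicGeometry.Motives
open Literature.AlgebraicGeometry.Motives.HodgeStructure (ofRat ofRat_apply mem_hodgeClasses_iff)
open Literature.AlgebraicGeometry.ShimuraVarieties (conjRingHomK embedding_conjRingHomK)

section Inner

open scoped Classical

variable (K : CMField) (hK : Module.finrank ℚ K = 4)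
include hK

/-- **one place**: for an even `±1`-valued `h`, `Σ_{f ∈ Ω} h (f x) ∈ {0, ±#Ω}` (the slot `f x` is
equidistributed over the four embeddings `x, x̄, z, z̄`, and `h x = h x̄`, `h z = h z̄`) -/
theorem tri_sum_twistSet_even (Ψ₀ : CMType K) (h : (K →+* ℂ) → ℤ) (heven : ∀ e, h (conjugate e) = h e)
    (hval : ∀ e, h e = 1 ∨ h e = -1) (x : K →+* ℂ) :
    Trichot (twistSet K).card (∑ f ∈ twistSet K, h (f x)) := by
  obtain ⟨z, hz, hz'⟩ := exists_ne_ne_conjugate Ψ₀ hK x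
  unfold Trichot
  rw [sum_twistSet_eval x h, card_twistSet_eq x, NumberField.Embeddings.card K ℂ, hK,
    sum_univ_of_finrank_eq_four Ψ₀ hK hz hz' h, heven, heven]
  rcases hval x with hx | hx <;> rcases hval z with hz1 | hz1 <;> rw [hx, hz1]
  · exact Or.inr (Or.inl (by push_cast; ring))
  · exact Or.inl (by ring)
  · exact Or.inl (by ring)
  · exact Or.inr (Or.inr (by push_cast; ring))

/-- **two places**: if `y ∉ {x, x̄}`, then `Σ_{q ∈ O_{x,y}} sgn_Ψ q₁ · sgn_Ψ' q₂ ∈ {0, ±#O_{x,y}}`.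
The pair orbit `O_{x,y}` consists of mixed pairs, is homogeneous over `π₁` with fibres of size `c ∈ {1, 2}`
(`#O = 4c`): for `c = 2` every fibre is `{(e,z), (e,z̄)}` and contributes `0`; for `c = 1` the orbit is
`{(x,y), (x̄,ȳ), (y,w), (ȳ,w̄)}` and the sum is `2·sgn x·sgn' y + 2·sgn y·sgn' w ∈ {0, ±4}`. -/
theorem tri_sum_pairSet (Ψ Ψ' : CMType K) {x y : K →+* ℂ} (hy : y ≠ x) (hy' : y ≠ conjugate x) :
    Trichot (pairSet x y).card (∑ q ∈ pairSet x y, sgn Ψ q.1 * sgn Ψ' q.2) := by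
  -- every pair of the orbit is mixed
  have hmix : ∀ q ∈ pairSet x y, q.2 ≠ q.1 ∧ q.2 ≠ conjugate q.1 := by
    intro q hq
    obtain ⟨γ, rfl⟩ := mem_pairSet.mp hq
    exact ⟨fun h => hy (twist_injective γ h),
      fun h => hy' (twist_injective γ (by rw [twist_conjugate]; exact h))⟩
  -- so the `π₁`-fibre over `e` lies in `{(e,z), (e,z̄)}` for any `z ∉ {e, ē}`
  have hsub : ∀ e z : K →+* ℂ, z ≠ e → z ≠ conjugate e →
      ((pairSet x y).filter fun u => u.1 = e) ⊆ {(e, z), (e, conjugate z)} := by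
    intro e z hz hz' u hu
    rw [Finset.mem_filter] at hu
    obtain ⟨hu, rfl⟩ := hu
    have hm := hmix u hu
    rw [Finset.mem_insert, Finset.mem_singleton]
    rcases eq_or_of_finrank_eq_four Ψ hK hz hz' u.2 with h | h | h | h
    · exact absurd h hm.1
    · exact absurd h hm.2
    · exact Or.inl (Prod.ext rfl h)
    · exact Or.inr (Prod.ext rfl h)
  -- the common fibre size `c ∈ {1, 2}`, `#O = 4c`
  obtain ⟨c, hc⟩ : ∃ c : ℕ, ((pairSet x y).filter fun u => u.1 = x).card = c := ⟨_, rfl⟩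
  have hcard : (pairSet x y).card = c * 4 := by
    rw [card_pairSet_eq, NumberField.Embeddings.card K ℂ, hK, hc]
  have hfib : ∀ e, ((pairSet x y).filter fun u => u.1 = e).card = c := by
    intro e
    obtain ⟨γ, hγ⟩ := exists_twist_eq x e
    have h := card_fibre_pairSet (twist_mem_pairSet (x := x) (y := y) γ)
    rw [hγ, hc] at h
    exact h
  have hc1 : 1 ≤ c := by
    rw [← hc]
    exact Finset.card_pos.mpr ⟨(x, y), Finset.mem_filter.mpr ⟨self_mem_pairSet x y, rfl⟩⟩
  have hc2 : c ≤ 2 := by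
    rw [← hc]
    exact (Finset.card_le_card (hsub x y hy hy')).trans Finset.card_le_two
  -- decompose the sum along `π₁`
  obtain ⟨G, hG⟩ : ∃ G : (K →+* ℂ) → ℤ,
      ∀ e, G e = ∑ q ∈ (pairSet x y).filter (fun u => u.1 = e), sgn Ψ q.1 * sgn Ψ' q.2 :=
    ⟨_, fun _ => rfl⟩
  have hdec : ∑ q ∈ pairSet x y, sgn Ψ q.1 * sgn Ψ' q.2 = ∑ e, G e :=
    (Finset.sum_fiberwise (pairSet x y) Prod.fst (fun q => sgn Ψ q.1 * sgn Ψ' q.2)).symm.trans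
      (Finset.sum_congr rfl fun e _ => (hG e).symm)
  rw [hdec]
  rcases (show c = 1 ∨ c = 2 by omega) with h1 | h2
  · -- `c = 1`: the orbit is `{(x,y), (x̄,ȳ), (y,w), (ȳ,w̄)}`
    have hsing : ∀ (e : K →+* ℂ) (q : (K →+* ℂ) × (K →+* ℂ)), q ∈ pairSet x y → q.1 = e →
        ((pairSet x y).filter fun u => u.1 = e) = {q} := by
      intro e q hq hqe
      obtain ⟨a, ha⟩ := Finset.card_eq_one.mp ((hfib e).trans h1)
      have hqa : q ∈ ({a} : Finset ((K →+* ℂ) × (K →+* ℂ))) := by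
        rw [← ha]; exact Finset.mem_filter.mpr ⟨hq, hqe⟩
      rw [Finset.mem_singleton] at hqa
      rw [ha, hqa]
    obtain ⟨γ₀, hγ₀⟩ := exists_twist_eq x y
    have hyw : (y, twist γ₀ y) ∈ pairSet x y := by
      have h := twist_mem_pairSet (x := x) (y := y) γ₀
      rwa [hγ₀] at h
    have hyw' : (conjugate y, conjugate (twist γ₀ y)) ∈ pairSet x y := by
      have h := twist_mem_pairSet (x := x) (y := y) (Obj.kap * γ₀)
      rwa [twist_mul, twist_mul, hγ₀, twist_kap, twist_kap] at h
    have hxy' : (conjugate x, conjugate y) ∈ pairSet x y := by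
      have h := twist_mem_pairSet (x := x) (y := y) Obj.kap
      rwa [twist_kap, twist_kap] at h
    have hGx : G x = sgn Ψ x * sgn Ψ' y := by
      rw [hG, hsing x (x, y) (self_mem_pairSet x y) rfl, Finset.sum_singleton]
    have hGx' : G (conjugate x) = sgn Ψ x * sgn Ψ' y := by
      rw [hG, hsing (conjugate x) (conjugate x, conjugate y) hxy' rfl, Finset.sum_singleton]
      change sgn Ψ (conjugate x) * sgn Ψ' (conjugate y) = _
      rw [sgn_conjugate, sgn_conjugate]; ring
    have hGy : G y = sgn Ψ y * sgn Ψ' (twist γ₀ y) := by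
      rw [hG, hsing y (y, twist γ₀ y) hyw rfl, Finset.sum_singleton]
    have hGy' : G (conjugate y) = sgn Ψ y * sgn Ψ' (twist γ₀ y) := by
      rw [hG, hsing (conjugate y) (conjugate y, conjugate (twist γ₀ y)) hyw' rfl, Finset.sum_singleton]
      change sgn Ψ (conjugate y) * sgn Ψ' (conjugate (twist γ₀ y)) = _
      rw [sgn_conjugate, sgn_conjugate]; ring
    unfold Trichot
    rw [sum_univ_of_finrank_eq_four Ψ hK hy hy' G, hGx, hGx', hGy, hGy', hcard, h1]
    rcases sgn_eq_or Ψ x with ha | ha <;> rcases sgn_eq_or Ψ' y with hb | hb <;>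
      rcases sgn_eq_or Ψ y with hc' | hc' <;> rcases sgn_eq_or Ψ' (twist γ₀ y) with hd | hd <;>
        rw [ha, hb, hc', hd] <;> norm_num
  · -- `c = 2`: every fibre is a conjugate pair and contributes zero
    left
    refine Finset.sum_eq_zero fun e _ => ?_
    obtain ⟨z, hz, hz'⟩ := exists_ne_ne_conjugate Ψ hK e
    have hne : (e, z) ≠ (e, conjugate z) := fun h =>
      conjugate_ne_self_of_cmType Ψ z (Prod.ext_iff.mp h).2.symm
    have hP : ((pairSet x y).filter fun u => u.1 = e) = {(e, z), (e, conjugate z)} :=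
      Finset.eq_of_subset_of_card_le (hsub e z hz hz')
        ((Finset.card_pair hne).trans_le (by rw [hfib e, h2]))
    rw [hG, hP, Finset.sum_pair hne]
    change sgn Ψ e * sgn Ψ' z + sgn Ψ e * sgn Ψ' (conjugate z) = 0
    rw [sgn_conjugate]; ring

/-- **inner products of slot sign vectors**: for CM types `Ψ, Ψ'` and embeddings `x, y` of a quartic CM
field, `Σ_{f ∈ Ω_K} sgn_Ψ (f x) · sgn_Ψ' (f y) ∈ {0, ±#Ω_K}`. -/
theorem tri_inner (Ψ Ψ' : CMType K) (x y : K →+* ℂ) :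
    Trichot (twistSet K).card (∑ f ∈ twistSet K, sgn Ψ (f x) * sgn Ψ' (f y)) := by
  by_cases hy : y = x ∨ y = conjugate x
  · exact tri_inner_of_same_place K (fun h he hv => tri_sum_twistSet_even K hK Ψ h he hv) Ψ Ψ' x y hy
  rw [not_or] at hy
  have h1 : ∑ f ∈ twistSet K, sgn Ψ (f x) * sgn Ψ' (f y)
      = (((twistSet K).filter fun f => (f x, f y) = (x, y)).card : ℤ)
          * ∑ q ∈ pairSet x y, sgn Ψ q.1 * sgn Ψ' q.2 :=
    sum_twistSet_eval₂ x y (fun q => sgn Ψ q.1 * sgn Ψ' q.2)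
  rw [h1, card_twistSet_eq₂ x y]
  exact (tri_sum_pairSet K hK Ψ Ψ' hy.1 hy.2).mul _

/-- **the trichotomy in CM degree four** -/
theorem triInner_of_finrank_eq_four : TriInner K := fun Ψ Ψ' x y => tri_inner K hK Ψ Ψ' x y

end Inner

/-! ### 8. Constant holomorphy count forces balance, on objects presented over ONE CM field of degree ≤ 4 -/

/-- `X.Presented K`: every atom of `X` is `(K, Ψ_i)` read through a ring map `e_i : K → F_i` — the CM types of
the atoms are pulled back from CM types `Ψ_i` of the ONE field `K` (e.g. `A_{(K,Φ₀)} × ⋯ × A_{(K,Φₙ)}`). -/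
def Obj.Presented (K : CMField) (X : Obj) : Prop :=
  ∃ (Ψ : X.s.toType → CMType K) (e : ∀ i, (K →+* (X.atom i).F)),
    ∀ i (τ : (X.atom i).F →+* ℂ), τ ∈ (X.atom i).Φ ↔ τ.comp (e i) ∈ (Ψ i).1

section CntBal

open scoped Classical

variable (K : CMField)

/-- **B. `CntBal` from the trichotomy.** If `X` is presented over a CM field `K` satisfying `TriInner K`
(CM degree `2` or `4`), an index map `g` all of whose Galois translates `γ • g` have the same number of
holomorphic slots is balanced.

Proof. Read slot `j` as `(σ_j, Ψ_j)` with `σ_j ∈ Hom(K,ℂ)`; its type is `T_j = {γ | γσ_j ∈ Ψ_j}` and its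
SIGN VECTOR on `Ω_K` is `ψ_j(f) = sgn_{Ψ_j}(f σ_j)`. Constant count says `Σ_j ψ_j` is constant on `Ω_K`
(`= 2·cnt - k`); each `ψ_l` sums to zero over `Ω_K` (one-slot equidistribution); so
`0 = Σ_f (Σ_j ψ_j(f)) ψ_l(f) = Σ_j ⟨ψ_j, ψ_l⟩`. By §7 every `⟨ψ_j, ψ_l⟩ ∈ {0, ±#Ω}`, with `+#Ω` iff
`ψ_j = ψ_l` iff `T_j = T_l` and `-#Ω` iff `T_j = T_lᶜ`; hence `#{j : T_j = T_l} = #{j : T_j = T_lᶜ}` for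
every `l`, which is balance. -/
theorem Obj.cntBal_of_triInner (hT : TriInner K) (X : Obj) (hX : X.Presented K) : X.CntBal := by
  obtain ⟨Ψ, e, he⟩ := hX
  intro k g _ hcnt
  -- the slots read in `K`, and their types
  obtain ⟨σ, hσ⟩ : ∃ σ : Fin k → (K →+* ℂ), ∀ j, σ j = (g j).2.comp (e (g j).1) := ⟨_, fun _ => rfl⟩
  have htyp : ∀ j, X.typ (g j) = {γ | twist γ (σ j) ∈ (Ψ (g j).1).1} := fun j =>
    X.typ_eq_of_presentation (g j) (e _) (σ j) _ (he _) fun x => by rw [hσ]; rfl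
  have hhol : ∀ (γ : Gam) (j : Fin k), X.hol (X.gact γ (g j)) ↔ twist γ (σ j) ∈ (Ψ (g j).1).1 :=
    fun γ j => by rw [← Obj.mem_typ, htyp]; rfl
  -- the sign vectors `ψ_j` on `Ω_K`
  obtain ⟨ψ, hψ⟩ : ∃ ψ : Fin k → ((K →+* ℂ) → (K →+* ℂ)) → ℤ,
      ∀ j f, ψ j f = sgn (Ψ (g j).1) (f (σ j)) := ⟨_, fun _ _ => rfl⟩
  have hψpm : ∀ j, ∀ f ∈ twistSet K, ψ j f = 1 ∨ ψ j f = -1 := fun j f _ => by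
    rw [hψ]; exact sgn_eq_or _ _
  -- (H1) `Σ_j ψ_j(γ) = 2·cnt(γ • g) - k`, constant on `Ω_K` by hypothesis
  have hsumψ : ∀ γ : Gam, ∑ j, ψ j (twist γ) = 2 * (X.cnt (fun i => X.gact γ (g i)) : ℤ) - k := by
    intro γ
    rw [X.cnt_eq_card_filter, Finset.card_filter]
    push_cast
    rw [Finset.mul_sum]
    have hk : (k : ℤ) = ∑ _j : Fin k, (1 : ℤ) := by simp
    rw [hk, ← Finset.sum_sub_distrib]
    refine Finset.sum_congr rfl fun j _ => ?_
    rw [hψ]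
    by_cases hh : twist γ (σ j) ∈ (Ψ (g j).1).1
    · rw [sgn_of_mem hh, if_pos ((hhol γ j).mpr hh)]; norm_num
    · rw [sgn_of_not_mem hh, if_neg (fun h' => hh ((hhol γ j).mp h'))]; norm_num
  have hconst : ∀ f ∈ twistSet K, ∑ j, ψ j f = 2 * (X.cnt (fun i => X.gact 1 (g i)) : ℤ) - k := by
    intro f hf
    obtain ⟨γ, rfl⟩ := mem_twistSet.mp hf
    rw [hsumψ γ, hcnt γ 1]
  -- (H2) each `ψ_l` sums to zero over `Ω_K`
  have hzero : ∀ l, ∑ f ∈ twistSet K, ψ l f = 0 := by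
    intro l
    have h := sum_twistSet_eval (σ l) (sgn (Ψ (g l).1))
    rw [sum_sgn_univ, mul_zero] at h
    rw [← h]
    exact Finset.sum_congr rfl fun f _ => hψ l f
  -- (H3) `⟨ψ_j, ψ_l⟩ ∈ {0, ±#Ω}`
  have htri : ∀ j l, Trichot (twistSet K).card (∑ f ∈ twistSet K, ψ j f * ψ l f) := by
    intro j l
    have h := hT (Ψ (g j).1) (Ψ (g l).1) (σ j) (σ l)
    have heq : ∑ f ∈ twistSet K, ψ j f * ψ l f
        = ∑ f ∈ twistSet K, sgn (Ψ (g j).1) (f (σ j)) * sgn (Ψ (g l).1) (f (σ l)) :=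
      Finset.sum_congr rfl fun f _ => by rw [hψ, hψ]
    rwa [← heq] at h
  -- (H4) `ψ_j = ψ_l` on `Ω_K` iff `T_j = T_l`; `ψ_j = -ψ_l` iff `T_j = T_lᶜ`
  have hTeq : ∀ j l, (∀ f ∈ twistSet K, ψ j f = ψ l f) ↔ X.typ (g j) = X.typ (g l) := by
    intro j l
    constructor
    · intro h
      rw [htyp, htyp]
      ext γ
      simp only [Set.mem_setOf_eq]
      rw [← sgn_eq_one_iff, ← sgn_eq_one_iff, ← hψ, ← hψ, h _ (twist_mem_twistSet γ)]
    · intro h f hf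
      obtain ⟨γ, rfl⟩ := mem_twistSet.mp hf
      have hγ : twist γ (σ j) ∈ (Ψ (g j).1).1 ↔ twist γ (σ l) ∈ (Ψ (g l).1).1 := by
        rw [← hhol, ← hhol, ← Obj.mem_typ, ← Obj.mem_typ, h]
      rw [hψ, hψ]
      by_cases hm : twist γ (σ j) ∈ (Ψ (g j).1).1
      · rw [sgn_of_mem hm, sgn_of_mem (hγ.mp hm)]
      · rw [sgn_of_not_mem hm, sgn_of_not_mem (fun h' => hm (hγ.mpr h'))]
  have hTcompl : ∀ j l, (∀ f ∈ twistSet K, ψ j f = -ψ l f) ↔ X.typ (g j) = (X.typ (g l))ᶜ := by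
    intro j l
    constructor
    · intro h
      rw [htyp, htyp]
      ext γ
      simp only [Set.mem_setOf_eq, Set.mem_compl_iff]
      rw [← sgn_eq_one_iff, ← sgn_eq_one_iff, ← hψ, ← hψ, h _ (twist_mem_twistSet γ)]
      rcases hψpm l _ (twist_mem_twistSet γ) with h1 | h1 <;> rw [h1] <;> norm_num
    · intro h f hf
      obtain ⟨γ, rfl⟩ := mem_twistSet.mp hf
      have hγ : twist γ (σ j) ∈ (Ψ (g j).1).1 ↔ twist γ (σ l) ∉ (Ψ (g l).1).1 := by
        rw [← hhol, ← hhol, ← Obj.mem_typ, ← Obj.mem_typ, h, Set.mem_compl_iff]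
      rw [hψ, hψ]
      by_cases hm : twist γ (σ j) ∈ (Ψ (g j).1).1
      · rw [sgn_of_mem hm, sgn_of_not_mem (hγ.mp hm)]; norm_num
      · rw [sgn_of_not_mem hm, sgn_of_mem (not_not.mp fun h' => hm (hγ.mpr h'))]
  -- (H5) so `⟨ψ_j, ψ_l⟩ = #Ω · ([T_j = T_l] - [T_j = T_lᶜ])`
  have hval : ∀ j l, ∑ f ∈ twistSet K, ψ j f * ψ l f
      = (twistSet K).card * ((if X.typ (g j) = X.typ (g l) then 1 else 0)
          - (if X.typ (g j) = (X.typ (g l))ᶜ then 1 else 0)) := by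
    intro j l
    by_cases h1 : X.typ (g j) = X.typ (g l)
    · have h2 : X.typ (g j) ≠ (X.typ (g l))ᶜ := by rw [h1]; exact Obj.set_ne_compl _
      rw [if_pos h1, if_neg h2, sub_zero, mul_one]
      exact sum_mul_eq_card_of_eq _ _ _ ((hTeq j l).mpr h1) (hψpm l)
    by_cases h2 : X.typ (g j) = (X.typ (g l))ᶜ
    · rw [if_neg h1, if_pos h2, zero_sub, mul_neg, mul_one]
      exact sum_mul_eq_neg_card_of_eq_neg _ _ _ ((hTcompl j l).mpr h2) (hψpm l)
    rw [if_neg h1, if_neg h2, sub_zero, mul_zero]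
    rcases htri j l with h | h | h
    · exact h
    · exact absurd ((hTeq j l).mp (eq_of_sum_mul_eq_card _ _ _ (hψpm j) (hψpm l) h)) h1
    · exact absurd ((hTcompl j l).mp (eq_neg_of_sum_mul_eq_neg_card _ _ _ (hψpm j) (hψpm l) h)) h2
  -- summing (H5) over `j` against (H1), (H2): `#{j : T_j = T_l} = #{j : T_j = T_lᶜ}` for every `l`
  have key : ∀ l, X.tcnt g (X.typ (g l)) = X.tcnt g (X.typ (g l))ᶜ := by
    intro l
    have hsum0 : ∑ j, ∑ f ∈ twistSet K, ψ j f * ψ l f = 0 := by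
      rw [Finset.sum_comm]
      calc ∑ f ∈ twistSet K, ∑ j, ψ j f * ψ l f
          = ∑ f ∈ twistSet K, (2 * (X.cnt (fun i => X.gact 1 (g i)) : ℤ) - k) * ψ l f :=
            Finset.sum_congr rfl fun f hf => by rw [← Finset.sum_mul, hconst f hf]
        _ = 0 := by rw [← Finset.mul_sum, hzero l, mul_zero]
    have hsum1 : ((twistSet K).card : ℤ) * (∑ j, ((if X.typ (g j) = X.typ (g l) then 1 else 0)
        - (if X.typ (g j) = (X.typ (g l))ᶜ then 1 else 0) : ℤ)) = ∑ j, ∑ f ∈ twistSet K, ψ j f * ψ l f := by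
      rw [Finset.mul_sum]
      exact Finset.sum_congr rfl fun j _ => (hval j l).symm
    rw [hsum0] at hsum1
    have hne : ((twistSet K).card : ℤ) ≠ 0 := by exact_mod_cast twistSet_card_pos.ne'
    have h := (mul_eq_zero.mp hsum1).resolve_left hne
    rw [Finset.sum_sub_distrib, sub_eq_zero] at h
    rw [X.tcnt_eq_card_filter, X.tcnt_eq_card_filter, Finset.card_filter, Finset.card_filter]
    exact_mod_cast h
  -- balance
  intro T
  by_cases h1 : ∃ l, X.typ (g l) = T
  · obtain ⟨l, rfl⟩ := h1
    exact key l
  by_cases h2 : ∃ l, X.typ (g l) = Tᶜ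
  · obtain ⟨l, hl⟩ := h2
    have h := key l
    rw [hl, compl_compl] at h
    exact h.symm
  rw [X.tcnt_eq_card_filter, X.tcnt_eq_card_filter,
    Finset.card_eq_zero.mpr (Finset.filter_eq_empty_iff.mpr fun j _ hj => h1 ⟨j, hj⟩),
    Finset.card_eq_zero.mpr (Finset.filter_eq_empty_iff.mpr fun j _ hj => h2 ⟨j, hj⟩)]

/-- **B on the quartic sector.** -/
theorem Obj.cntBal_of_presented (hK : Module.finrank ℚ K = 4) (X : Obj) (hX : X.Presented K) : X.CntBal :=
  Obj.cntBal_of_triInner K (triInner_of_finrank_eq_four K hK) X hX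

/-- **B in CM degree at most four** (imaginary quadratic or quartic). -/
theorem Obj.cntBal_of_presented_of_finrank_le_four (hK : Module.finrank ℚ K ≤ 4) (X : Obj)
    (hX : X.Presented K) : X.CntBal := by
  rcases finrank_eq_two_or_eq_four_of_le_four K hK with h | h
  · exact Obj.cntBal_of_triInner K (triInner_of_finrank_eq_two K h) X hX
  · exact Obj.cntBal_of_presented K h X hX

end CntBal

end HodgeCM.Toy

end
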